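/-
Copyright (c) 2026 the pub-hodgecm-mathlib formalisation cell (harness21).  Prover seat hodgecm-mathlib-R90-CS-p03 (g2), R90-TF section S8 «ContSpec-n½» (dealer R90-CS-plan (g3);
the row `hcS` introduced by ★ FLAG ④ `K2E1ChiIntertwinedAmplitudeInvarianceU3`): THE SCALAR RATIO `c_S(z) = L^S(z−1,χ)·ζ^{T′}(2z−2) ∕ (L^S(z,χ)·ζ^{T′}(2z−1))` OF ★ F5's `hsrc` DOES NOT
VANISH ON `{2 < Re z}` (absolutely convergent Euler products of a unitary Hecke character).
-/
import Summits.HodgeConjecture.HodgeConjecture.Theorems.F0P2wPartialDedekindZetaPole          -- ★ `hasProd_partialStandardL_singleton` (`L^S(s, c) ≠ 0` for `‖c_v‖ ≤ 1`, `Re s > 1`)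
import Literature.NumberTheory.GaloisRepresentations.HeckeCharacterProofs                     -- ★ `HeckeCharacter.norm_valueAtUniformizer_of_isUnitary`
import Literature.NumberTheory.GaloisRepresentations.HeckeCharacterNormCharacter              -- ★ `HeckeCharacter.isUnitary_one`
import HarnessLib

/-!
# K2·E1 ∕ R90·S8 — `K2E1ChiScalarRatioNonvanishingU3`: THE ROW `hcS : ∀ z, 2 < Re z → c_S(z) ≠ 0` FOR THE SCALAR OF RECORD

Cell `pub/hodgecm-mathlib`, crux h413 = `stmt-HodgeConjecture-24833`, route of record `HCCMUnconditional`; R90-TF section S8 «ContSpec-n½», scalar road J-S8-SCAL.  In the (R)′ ∕ (V)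
OF-RECORD bills the intertwining scalar on `{2 < Re}` is ★ F5's `hsrc`:
`q z = A z · ((partialStandardL S (w ↦ {χ(ϖ_w)}) (z − 1) · partialStandardL T′ (v ↦ {𝟙(ϖ_v)}) (2z − 2)) ∕ (partialStandardL S (w ↦ {χ(ϖ_w)}) z · partialStandardL T′ (v ↦ {𝟙(ϖ_v)}) (2z − 1)))`
(`χ = ξ.bcη⁻¹·μω` unitary, `𝟙` the trivial Hecke character of `L⁺`), and the letter `cS` with `hq : q z = A z · cS z` is instantiated at that ratio.  ★ FLAG ④
(`K2E1ChiIntertwinedAmplitudeInvarianceU3`, rows `hAgB hAgN hAgm`) needs `hcS : ∀ z, 2 < z.re → cS z ≠ 0`; THIS FILE pays it: each of the four partial Euler products has parameters of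
modulus `≤ 1` (unitarity, ★ `norm_valueAtUniformizer_of_isUnitary`) and is evaluated at a point of real part `> 1` (`Re(z−1) > 1`, `Re(2z−2) > 2`, `Re z > 2`, `Re(2z−1) > 3`), where
★ `hasProd_partialStandardL_singleton` gives absolute convergence AND non-vanishing.  THEOREMS ONLY (no `def`, no `instance`, no notation, no named-fact hypothesis, no `sorry`); lane
`--supports stmt-HodgeConjecture-24833 --as helper` (count-neutral).  Closes no socket.
* `partialStandardL_valueAtUniformizer_ne_zero` — `L^S(s, χ) ≠ 0` for unitary `χ`, `Re s > 1` (any field, any `S`).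
* HEAD **`scalarRatio_ne_zero`** — the four-factor ratio is `≠ 0` on `{2 < Re}` for unitary `χ` on `K` and unitary `χ′` on `K′` (of record: `χ′ = 1`, `scalarRatio_one_ne_zero`).
HONEST LABEL: HC_CM is proved only modulo the 7 printed citations (2 remaining named inputs: hLiu418 = `stmt-HodgeConjecture-24832`, h413 = `stmt-HodgeConjecture-24833`) until rung 0
closes; REL ≠ ★ ≠ BUILT; this file asserts no named fact and closes no socket; count-neutral.

## References
* [NeukirchANT1999] J. Neukirch, *Algebraic Number Theory* (1999): Ch. VII §8, (8.1) (absolute convergence and non-vanishing of Hecke `L`-series on `Re s > 1`).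
* [MoeglinWaldspurger1995] C. Mœglin, J.-L. Waldspurger, *Spectral Decomposition and Eisenstein Series* (1995): IV.1.11.
-/

set_option autoImplicit false
set_option linter.dupNamespace false -- the mandated namespace repeats `HodgeConjecture.HodgeConjecture`

noncomputable section

open NumberField IsDedekindDomain
open Literature.NumberTheory.Automorphic Literature.NumberTheory.GaloisRepresentations
open Summit.HodgeConjecture.HodgeConjecture.Cruxes.H413.F0P2wPartialDedekindZetaPole (hasProd_partialStandardL_singleton)

namespace Summit.HodgeConjecture.HodgeConjecture.Cruxes.H413.K2E1ChiScalarRatioNonvanishingU3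

/-- **`L^S(s, χ) ≠ 0` FOR A UNITARY HECKE CHARACTER AND `Re s > 1`** (the partial Euler product `∏_{v∉S}(1 − χ(ϖ_v)q_v^{−s})⁻¹` converges absolutely and no factor vanishes; ★
`hasProd_partialStandardL_singleton` with `‖χ(ϖ_v)‖ = 1`). [cite: NeukirchANT1999, Ch. VII §8 (8.1)] -/
theorem partialStandardL_valueAtUniformizer_ne_zero {K : Type} [Field K] [NumberField K] (S : Set (HeightOneSpectrum (𝓞 K))) {χ : HeckeCharacter K} (hχ : χ.IsUnitary)
    {s : ℂ} (hs : 1 < s.re) : partialStandardL S (fun v => {χ.valueAtUniformizer v}) s ≠ 0 :=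
  (hasProd_partialStandardL_singleton (S := S) (fun v => χ.valueAtUniformizer v) (fun v _ => (HeckeCharacter.norm_valueAtUniformizer_of_isUnitary hχ v).le) hs).2

/-- The four real parts: for `2 < Re z`, `1 < Re(z − 1)`, `1 < Re(2z − 2)`, `1 < Re z`, `1 < Re(2z − 1)`. [folklore] -/
theorem one_lt_re_shifts {z : ℂ} (hz : 2 < z.re) : 1 < (z - 1).re ∧ 1 < (2 * z - 2).re ∧ 1 < z.re ∧ 1 < (2 * z - 1).re := by
  have h2 : (2 * z).re = 2 * z.re := by simp [Complex.mul_re]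
  refine ⟨?_, ?_, by linarith, ?_⟩
  · rw [Complex.sub_re, Complex.one_re]; linarith
  · rw [Complex.sub_re, h2]; norm_num; linarith
  · rw [Complex.sub_re, Complex.one_re, h2]; linarith

/-- **HEAD.  THE SCALAR RATIO OF RECORD IS NON-ZERO ON `{2 < Re}`**: for unitary Hecke characters `χ` of `K` and `χ′` of `K′`, any place sets `S`, `T′`, and `2 < Re z`,
`(L^S(z−1,χ)·L^{T′}(2z−2,χ′)) ∕ (L^S(z,χ)·L^{T′}(2z−1,χ′)) ≠ 0` — numerator and denominator are products of non-vanishing absolutely convergent Euler products.  The row `hcS` of ★ FLAG ④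
at `cS := ` ★ F5's `hsrc` ratio (`χ = ξ.bcη⁻¹·μω`, `χ′ = 1`). [cite: NeukirchANT1999, Ch. VII §8 (8.1)] [cite: MoeglinWaldspurger1995, IV.1.11] -/
theorem scalarRatio_ne_zero {K K' : Type} [Field K] [NumberField K] [Field K'] [NumberField K'] (S : Set (HeightOneSpectrum (𝓞 K))) (T' : Set (HeightOneSpectrum (𝓞 K')))
    {χ : HeckeCharacter K} (hχ : χ.IsUnitary) {χ' : HeckeCharacter K'} (hχ' : χ'.IsUnitary) {z : ℂ} (hz : 2 < z.re) :
    (partialStandardL S (fun w => {χ.valueAtUniformizer w}) (z - 1) * partialStandardL T' (fun v => {χ'.valueAtUniformizer v}) (2 * z - 2)) /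
        (partialStandardL S (fun w => {χ.valueAtUniformizer w}) z * partialStandardL T' (fun v => {χ'.valueAtUniformizer v}) (2 * z - 1)) ≠ 0 := by
  obtain ⟨h1, h2, h3, h4⟩ := one_lt_re_shifts hz
  exact div_ne_zero (mul_ne_zero (partialStandardL_valueAtUniformizer_ne_zero S hχ h1) (partialStandardL_valueAtUniformizer_ne_zero T' hχ' h2))
    (mul_ne_zero (partialStandardL_valueAtUniformizer_ne_zero S hχ h3) (partialStandardL_valueAtUniformizer_ne_zero T' hχ' h4))

/-- **THE ROW `hcS` IN THE BYTES OF RECORD** (`χ′ = 1`, the trivial Hecke character of `K′ = L⁺`, unitary by ★ `isUnitary_one`): for unitary `χ` and all `z` with `2 < Re z`,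
`(L^S(z−1,χ)·partialStandardL T′ (v ↦ {(1 : HeckeCharacter K′).valueAtUniformizer v}) (2z−2)) ∕ (L^S(z,χ)·partialStandardL T′ (…) (2z−1)) ≠ 0`. [cite: NeukirchANT1999, Ch. VII §8 (8.1)] -/
theorem scalarRatio_one_ne_zero {K K' : Type} [Field K] [NumberField K] [Field K'] [NumberField K'] (S : Set (HeightOneSpectrum (𝓞 K))) (T' : Set (HeightOneSpectrum (𝓞 K')))
    {χ : HeckeCharacter K} (hχ : χ.IsUnitary) :
    ∀ z : ℂ, 2 < z.re →
      (partialStandardL S (fun w => {χ.valueAtUniformizer w}) (z - 1) * partialStandardL T' (fun v => {(1 : HeckeCharacter K').valueAtUniformizer v}) (2 * z - 2)) /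
          (partialStandardL S (fun w => {χ.valueAtUniformizer w}) z * partialStandardL T' (fun v => {(1 : HeckeCharacter K').valueAtUniformizer v}) (2 * z - 1)) ≠ 0 :=
  fun _ hz => scalarRatio_ne_zero S T' hχ HeckeCharacter.isUnitary_one hz

end Summit.HodgeConjecture.HodgeConjecture.Cruxes.H413.K2E1ChiScalarRatioNonvanishingU3

end
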